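import Literature.Probability.Independence.Grouping
import Summits.Ventures.LatticeQCDFlow.Scoring.PairedDrawAcceptance
import HarnessLib

/-!
# Disjoint pairs of ONE independent proposal stream are independent pairs (the bookkeeping behind
# `Scoring/PairedDrawAcceptance`)

HONEST FRAMING: exact (Metropolis-corrected) sampling algorithms for lattice gauge theory;
figures of merit are autocorrelation/cost numbers at stated couplings and volumes; no
continuum-physics claim.

Venture `LatticeQCDFlow` (cell pub-lqcd), topic `Scoring`; FANOUT row 4 (`s0-u1-b`).
`Scoring/PairedDrawAcceptance` certifies the equilibrium acceptance `acc(p,q)` of a flow sampler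
from `k` INDEPENDENT PAIRS `(xᵢ, x'ᵢ)` of model draws, taking as hypotheses that each pair is
independent inside (`hin : ∀ i, xᵢ ⟂ x'ᵢ`) and that the pairs are independent as pair-valued random
variables (`hpair : iIndepFun (fun i ω ↦ (xᵢ ω, x'ᵢ ω))`), and lists as NOT CLAIMED "the
bookkeeping that disjoint pairs of one i.i.d. stream satisfy `hpair`/`hin`".  This file supplies it
from the grouping corollary for independent σ-fields (Kallenberg 2021 Cor. 3.7, tree
`Literature.Probability.Independence.iIndepFun_comp_of_pairwise_disjoint`): for ONE stream of
independent draws `y : Fin n → Ω → X` and `2k ≤ n`, the consecutive pairs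
`xᵢ = y_{2i}`, `x'ᵢ = y_{2i+1}` (`i < k`) satisfy both hypotheses —

* `indepFun_streamPair` (`hin`), `iIndepFun_streamPairs` (`hpair`);
* `acceptance_streamPairs_confidence` — `PairedDraws.acceptance_pairedDraws_confidence` restated
  for the stream: with `V = Σ_{i<k} min(w(y_{2i}), w(y_{2i+1}))`, `w = p/q`, ceiling `p ≤ Wq`,
  `k ≥ 1`, `t > 0`: `P(t ≤ |V/k − acc(p,q)|) ≤ exp(−kt²/2) + exp(−kt²/(2(1 + Wt/3)))`.

NEW WORK of the cell (elementary bookkeeping); no definition; no number of ours, no sealed value.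
The all-pairs (U-statistic) estimator from the same stream is `Scoring/AllPairsAcceptance`.
-/

noncomputable section

namespace Summit.Ventures.LatticeQCDFlow.Scoring.PairedDraws

open MeasureTheory ProbabilityTheory Finset Real Set

variable {Ω : Type*} [MeasurableSpace Ω] {P : Measure Ω}
variable {X : Type*} [MeasurableSpace X] {n k : ℕ}

/-- The index `2i + a` of the `a`-th member (`a = 0, 1`) of the `i`-th consecutive pair, as an
element of `Fin n` (`2k ≤ n`). [ours] -/
theorem two_mul_add_lt (hk : 2 * k ≤ n) (i : Fin k) (a : Fin 2) : 2 * (i : ℕ) + a < n := by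
  have hi := i.isLt; have ha := a.isLt; omega

/-- Distinct (pair, member) labels give distinct stream indices. [ours] -/
theorem two_mul_add_injective {i j : ℕ} {a b : Fin 2} (h : 2 * i + (a : ℕ) = 2 * j + b) :
    i = j ∧ a = b := by
  have ha := a.isLt; have hb := b.isLt
  refine ⟨by omega, Fin.ext (by omega)⟩

/-- **`hin`: the two members of a consecutive pair of an independent stream are independent.**
[ours] -/
theorem indepFun_streamPair {y : Fin n → Ω → X} (hind : iIndepFun y P) (hk : 2 * k ≤ n)
    (i : Fin k) :
    IndepFun (y ⟨2 * (i : ℕ) + ((0 : Fin 2) : ℕ), two_mul_add_lt hk i 0⟩)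
      (y ⟨2 * (i : ℕ) + ((1 : Fin 2) : ℕ), two_mul_add_lt hk i 1⟩) P :=
  hind.indepFun (fun h => by
    have h' := congrArg Fin.val h
    simp at h')

/-- **`hpair`: the consecutive pairs of an independent stream are independent as pair-valued random
variables** (grouping of independent σ-fields along the disjoint blocks `{2i, 2i+1}`). [ours] -/
theorem iIndepFun_streamPairs {y : Fin n → Ω → X} (hym : ∀ j, Measurable (y j))
    (hind : iIndepFun y P) (hk : 2 * k ≤ n) :
    iIndepFun (fun (i : Fin k) ω =>
      (y ⟨2 * (i : ℕ) + ((0 : Fin 2) : ℕ), two_mul_add_lt hk i 0⟩ ω,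
        y ⟨2 * (i : ℕ) + ((1 : Fin 2) : ℕ), two_mul_add_lt hk i 1⟩ ω)) P := by
  have h := Literature.Probability.Independence.iIndepFun_comp_of_pairwise_disjoint hym hind
    (α := fun _ : Fin k => Fin 2)
    (fun i a => (⟨2 * (i : ℕ) + (a : ℕ), two_mul_add_lt hk i a⟩ : Fin n)) ?_
    (T := fun _ => X × X) (fun _ v => (v 0, v 1))
    fun _ => (measurable_pi_apply 0).prodMk (measurable_pi_apply 1)
  · exact h
  · intro i j hij a b hab
    have h' := congrArg Fin.val hab
    simp only at h'
    exact hij (Fin.ext (two_mul_add_injective h').1)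

/-- **The paired-draws acceptance certificate from ONE proposal stream.**  `n` independent model
draws `y₀,…,y_{n−1}` (laws `μ.withDensity q`), `1 ≤ k`, `2k ≤ n`, ceiling `p ≤ Wq`, `t > 0`; with
`V = Σ_{i<k} min(w(y_{2i}), w(y_{2i+1}))`:
`P(t ≤ |V/k − acc(p,q)|) ≤ exp(−kt²/2) + exp(−kt²/(2(1 + Wt/3)))`. [ours] -/
theorem acceptance_streamPairs_confidence [IsProbabilityMeasure P] {μ : Measure X} [SFinite μ]
    {y : Fin n → Ω → X} (hym : ∀ j, Measurable (y j)) (hind : iIndepFun y P) {p q : X → ℝ}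
    (hp0 : ∀ z, 0 ≤ p z) (hpm : Measurable p) (hpi : Integrable p μ) (hp1 : ∫ z, p z ∂μ = 1)
    (hq0 : ∀ z, 0 < q z) (hqm : Measurable q) (hqi : Integrable q μ) {W : ℝ}
    (hW : ∀ z, p z ≤ W * q z)
    (hlaw : ∀ j, Measure.map (y j) P = μ.withDensity fun z => ENNReal.ofReal (q z))
    (hk0 : 0 < k) (hk : 2 * k ≤ n) {t : ℝ} (ht : 0 < t) :
    P.real {ω | t ≤ |(∑ i : Fin k,
          min (p (y ⟨2 * (i : ℕ) + ((0 : Fin 2) : ℕ), two_mul_add_lt hk i 0⟩ ω)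
                / q (y ⟨2 * (i : ℕ) + ((0 : Fin 2) : ℕ), two_mul_add_lt hk i 0⟩ ω))
              (p (y ⟨2 * (i : ℕ) + ((1 : Fin 2) : ℕ), two_mul_add_lt hk i 1⟩ ω)
                / q (y ⟨2 * (i : ℕ) + ((1 : Fin 2) : ℕ), two_mul_add_lt hk i 1⟩ ω))) / k
          - ∫ a, ∫ b, min (p a * q b) (p b * q a) ∂μ ∂μ|}
      ≤ Real.exp (-(k * t ^ 2 / 2)) + Real.exp (-(k * t ^ 2 / (2 * (1 + W * t / 3)))) := by
  have h := acceptance_pairedDraws_confidence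
    (x := fun (i : Fin k) => y ⟨2 * (i : ℕ) + ((0 : Fin 2) : ℕ), two_mul_add_lt hk i 0⟩)
    (x' := fun (i : Fin k) => y ⟨2 * (i : ℕ) + ((1 : Fin 2) : ℕ), two_mul_add_lt hk i 1⟩)
    (fun i => hym _) (fun i => hym _) (fun i => indepFun_streamPair hind hk i)
    (iIndepFun_streamPairs hym hind hk) hp0 hpm hpi hp1 hq0 hqm hqi hW (fun i => hlaw _)
    (fun i => hlaw _) (univ : Finset (Fin k)) (by simpa using hk0) ht
  simpa only [card_univ, Fintype.card_fin] using h

end Summit.Ventures.LatticeQCDFlow.Scoring.PairedDraws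

end
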